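import Mathlib
import Summits.Ventures.HodgeRepro.Tier4.Line1.RTFSetting
import Summits.Ventures.HodgeRepro.Tier4.Line1.InnerCalculus
import Summits.Ventures.HodgeRepro.Tier4.Line1.InnerBridge
import Summits.Ventures.HodgeRepro.Tier4.Line1.OrthComplement
import Summits.Ventures.HodgeRepro.Tier4.Line1.MaximalFamily
import Summits.Ventures.HodgeRepro.Tier4.Line1.AdaptedONBGlue
import Summits.Ventures.HodgeRepro.Tier4.Line4.AdaptedONBPrefix

/-!
# Tier4/Line4/AdaptedONBExtending — an adapted ONB with PRESCRIBED constituents and PRESCRIBED finite blocks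

Blind re-derivation cell `pub-hodge-repro`, Tier 4 «prove the step» (README §9–§10), seat t4-L4-p1 (prover, LINE L4,
gen 3; self-pointed cut S13497).  Tree path `lean/Summits/Ventures/HodgeRepro/Tier4/Line4/AdaptedONBExtending.lean`.
Mathlib-level; no literature.  Generic over any `S : RTF.Setting G` (L1's vocabulary, `Line1/RTFSetting`); the rungs
are `Line4/AdaptedONBPrefix.lean`.

WHAT IS PROVED.  The J1 glue (`Line1/AdaptedONBGlue.exists_adaptedONB_of_rungs`, t4-L4-p1 g0) produces SOME adapted
orthonormal basis (`IsAdaptedONB τ φ n`) of `L²(DG)` along irreducible invariant subspaces.  The wall W3″ of LINE L4, as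
displayed by `Line4/W3Reduction.mixed_two_torus_W3_of_spectral_data` (t4-L1-p5), consumes an adapted ONB whose
constituents CONTAIN given admissible subspaces and whose finite blocks `F i` SPAN given finite-dimensional subspaces
of them (the conjugate `K`-type spaces).  `exists_adaptedONB_extending` proves that such a basis exists from
basis-free data: for a finite family `V i` of pairwise `S.inner`-orthogonal non-zero irreducible invariant subspaces
and finite-dimensional submodules `Wfd i ⊆ V i`, under the two hypotheses of the glue (`hinf`, `h4b`), there are
`τ φ n` with `S.IsAdaptedONB τ φ n`, `τ i = V i` for `i < m`, and pairwise disjoint finite blocks `F i` with `n j = i`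
on `F i` and `span (φ '' F i) = Wfd i` (an equality of submodules of FUNCTIONS, not of classes).  Assembly: Zorn above
the given family, enumeration with the given family first, in each constituent the glue's Gram–Schmidt with the
function-level orthonormal basis of `Wfd i` as the kept prefix (`AdaptedONBPrefix`), then the glue's assembly
(totality by maximality, `Denumerable` listing of the non-zero vectors, continuous representatives) with the block
bookkeeping — a block index lists exactly the prefix functions (`eq_of_toL2_eq`: equal classes, equal functions).

HC_CM is NOT proved by anyone in this repository.
-/

set_option autoImplicit false

noncomputable section

namespace Summit.Ventures.HodgeRepro.Tier4.Line4

open Summit.Ventures.HodgeRepro.Tier4.Line1 MeasureTheory Topology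
open scoped ComplexConjugate InnerProductSpace

variable {G : Type} [Group G] [TopologicalSpace G] [IsTopologicalGroup G] [MeasurableSpace G]
  [BorelSpace G]

variable (S : RTF.Setting G)

section Assembly

/-- Two continuous invariant functions with the same `L²(DG)`-class are equal. -/
theorem eq_of_toL2_eq [Countable S.Gk] {ψ ψ' : G → ℂ} (hψ : S.Invariant ψ) (hc : Continuous ψ)
    (hψ' : S.Invariant ψ') (hc' : Continuous ψ') (h : S.toL2 hc = S.toL2 hc') : ψ = ψ' :=
  S.eq_of_ae_eq_DG hψ hc hψ' hc' ((MemLp.toLp_eq_toLp_iff (S.memLp_restrict_of_continuous hc)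
    (S.memLp_restrict_of_continuous hc')).1 h)

/-- **An adapted ONB with PRESCRIBED constituents and PRESCRIBED finite blocks** (the glue
`exists_adaptedONB_of_rungs` with the block bookkeeping): under the glue's two hypotheses (`hinf`: `L²(DG)` is not
finite-dimensional; `h4b`: rung (4b) displayed), for a finite family `V i` (`i < m`) of pairwise `S.inner`-orthogonal
non-zero irreducible invariant subspaces and finite-dimensional submodules `Wfd i ⊆ V i`, there is an adapted ONB
`τ φ n` (`S.IsAdaptedONB τ φ n`) with `τ i = V i` for `i < m` and pairwise disjoint finite blocks `F i ⊆ ℕ` such that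
`n j = i` on `F i` and `span (φ '' F i) = Wfd i` — an equality of submodules of FUNCTIONS `G → ℂ`. -/
theorem exists_adaptedONB_extending [SecondCountableTopology G] [LocallyCompactSpace G]
    (hinf : ¬ FiniteDimensional ℂ (Lp ℂ 2 (S.μ.restrict S.DG)))
    (h4b : ∀ V : Set (G → ℂ), S.IsInvariantSubspace V →
      (∀ ψ : G → ℂ, Continuous ψ → S.Invariant ψ →
        (∀ ε : ℝ, 0 < ε → ∃ ψ' ∈ V,
          eLpNorm (fun x => ψ x - ψ' x) 2 (S.μ.restrict S.DG) < ENNReal.ofReal ε) → ψ ∈ V) →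
      (∃ ψ ∈ V, ∃ x, ψ x ≠ 0) →
      ∃ V' : Set (G → ℂ), S.IsInvariantSubspace V' ∧ V' ⊆ V ∧ S.IsIrreducible V' ∧ ∃ ψ ∈ V', ∃ x, ψ x ≠ 0)
    {m : ℕ} (V : Fin m → Set (G → ℂ)) (hV : ∀ i, S.IsIrrNonzero (V i))
    (horth : ∀ i i', i ≠ i' → ∀ ψ ∈ V i, ∀ ψ' ∈ V i', S.inner ψ ψ' = 0)
    (Wfd : Fin m → Submodule ℂ (G → ℂ)) (hW : ∀ i, (Wfd i : Set (G → ℂ)) ⊆ V i)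
    (hWfin : ∀ i, FiniteDimensional ℂ (Wfd i)) :
    ∃ (τ : ℕ → Set (G → ℂ)) (φ : ℕ → G → ℂ) (n : ℕ → ℕ), S.IsAdaptedONB τ φ n ∧
      (∀ i : Fin m, τ i = V i) ∧
      ∃ F : Fin m → Finset ℕ, (∀ i i', i ≠ i' → Disjoint (F i) (F i')) ∧
        (∀ i, ∀ j ∈ F i, n j = i) ∧
        ∀ i, Submodule.span ℂ (φ '' (F i : Set ℕ)) = Wfd i := by
  classical
  haveI : Countable S.Gk := S.countable_Gk
  -- the given family is an injective orthogonal family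
  have hVinj : Function.Injective V := by
    intro i i' h
    by_contra hne
    obtain ⟨ψ, hψ, x, hx⟩ := (hV i).2.2
    have h0 : S.inner ψ ψ = 0 := horth i i' hne ψ hψ ψ (h ▸ hψ)
    have := S.eq_zero_of_inner_self_eq_zero ((hV i).1.inv ψ hψ) ((hV i).1.cont ψ hψ) h0
    exact hx (by rw [this]; rfl)
  have hF₀ : S.IsOrthFamily (Set.range V) := by
    refine ⟨?_, ?_⟩
    · rintro _ ⟨i, rfl⟩
      exact hV i
    · rintro _ ⟨i, rfl⟩ _ ⟨i', rfl⟩ hne ψ hψ ψ' hψ'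
      exact horth i i' (fun h => hne (h ▸ rfl)) ψ hψ ψ' hψ'
  obtain ⟨F, hF, hF₀F, hmax⟩ := exists_maximal_orthFamily_extending S hF₀
  obtain ⟨τ, hinv, hirr, horthSub, hτV, hall⟩ :=
    exists_enumeration_orthFamily_first S hF V (fun i => hF₀F ⟨i, rfl⟩) hVinj
  -- function-level orthonormal bases of the `Wfd i`
  have hbasis : ∀ i : Fin m, ∃ (d : ℕ) (w : ℕ → G → ℂ), (∀ k < d, w k ∈ Wfd i) ∧
      (∀ k < d, ∀ k' < d, S.inner (w k) (w k') = if k = k' then 1 else 0) ∧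
      Submodule.span ℂ (w '' (Finset.range d : Set ℕ)) = Wfd i := fun i =>
    haveI := hWfin i
    exists_orthonormal_fun_basis S (hV i).1 (Wfd i) (hW i)
  choose d w hwmem hworth hwspan using hbasis
  -- the prefix data at every index `j : ℕ`
  let dj : ℕ → ℕ := fun j => if h : j < m then d ⟨j, h⟩ else 0
  let wj : ℕ → ℕ → G → ℂ := fun j => if h : j < m then w ⟨j, h⟩ else fun _ => 0
  have hdj : ∀ i : Fin m, dj i = d i := fun i => by simp only [dj, dif_pos i.2]
  have hwj : ∀ i : Fin m, wj i = w i := fun i => by simp only [wj, dif_pos i.2]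
  have hdj0 : ∀ j, m ≤ j → dj j = 0 := fun j h => by simp only [dj, dif_neg (not_lt.2 h)]
  have hwjmem : ∀ j, ∀ k < dj j, wj j k ∈ τ j := by
    intro j k hk
    by_cases h : j < m
    · have e1 := hdj ⟨j, h⟩
      have e2 := hwj ⟨j, h⟩
      simp only at e1 e2
      rw [e1] at hk
      rw [e2, hτV ⟨j, h⟩]
      exact hW _ (hwmem _ k hk)
    · rw [hdj0 j (not_lt.1 h)] at hk
      exact absurd hk (Nat.not_lt_zero k)
  have hwjorth : ∀ j, ∀ k < dj j, ∀ k' < dj j, S.inner (wj j k) (wj j k') = if k = k' then 1 else 0 := by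
    intro j k hk k' hk'
    by_cases h : j < m
    · have e1 := hdj ⟨j, h⟩
      have e2 := hwj ⟨j, h⟩
      simp only at e1 e2
      rw [e1] at hk hk'
      rw [e2]
      exact hworth _ k hk k' hk'
    · rw [hdj0 j (not_lt.1 h)] at hk
      exact absurd hk (Nat.not_lt_zero k)
  -- Gram–Schmidt in every constituent, prefix kept
  have hGS : ∀ j : ℕ, ∃ g : ℕ → Lp ℂ 2 (S.μ.restrict S.DG),
      (∀ (k : ℕ) (hk : k < dj j), g k = S.toL2 ((hinv j).cont _ (hwjmem j k hk))) ∧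
      (∀ k, g k ≠ 0 → g k ∈ S.clsSet (τ j)) ∧
      (∀ k k', g k ≠ 0 → g k' ≠ 0 → ⟪g k, g k'⟫_ℂ = if k = k' then 1 else 0) ∧
      ∀ u ∈ S.clsSet (τ j), ∀ v : Lp ℂ 2 (S.μ.restrict S.DG), (∀ k, ⟪g k, v⟫_ℂ = 0) → ⟪u, v⟫_ℂ = 0 :=
    fun j => exists_gramSchmidt_prefix S (hinv j) (dj j) (wj j) (hwjmem j) (hwjorth j)
  choose g hg_pre hg_mem hg_orth hg_dense using hGS
  -- orthonormality across the whole doubly-indexed family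
  have key : ∀ p q : ℕ × ℕ, g p.1 p.2 ≠ 0 → g q.1 q.2 ≠ 0 →
      ⟪g p.1 p.2, g q.1 q.2⟫_ℂ = if p = q then 1 else 0 := by
    rintro ⟨j, k⟩ ⟨j', k'⟩ hp hq
    by_cases hj : j = j'
    · subst hj
      rw [hg_orth j k k' hp hq]
      simp only [Prod.mk.injEq, true_and]
    · rw [if_neg (fun h => hj (Prod.mk.injEq _ _ _ _ ▸ h).1)]
      obtain ⟨ψ, hψ, hc, hψeq⟩ := hg_mem _ _ hp
      obtain ⟨ψ', hψ', hc', hψ'eq⟩ := hg_mem _ _ hq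
      simp only at hψeq hψ'eq
      rw [hψeq, hψ'eq, ← S.inner_eq_inner_toL2 hc' hc]
      exact horthSub j' j (Ne.symm hj) ψ' hψ' ψ hψ
  -- totality of the doubly-indexed family
  have htotal : ∀ v : Lp ℂ 2 (S.μ.restrict S.DG),
      (∀ p ∈ {p : ℕ × ℕ | g p.1 p.2 ≠ 0}, ⟪g p.1 p.2, v⟫_ℂ = 0) → v = 0 := by
    intro v hv
    have hv' : ∀ j k, ⟪g j k, v⟫_ℂ = 0 := fun j k => by
      by_cases h : g j k = 0
      · rw [h, _root_.inner_zero_left]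
      · exact hv (j, k) h
    have horth' : ∀ W ∈ F, ∀ ψ ∈ W, S.inner v ψ = 0 := by
      intro W hWF ψ hψ
      obtain ⟨j, hj⟩ := hall W hWF
      rw [← hj] at hψ
      have hc : Continuous ψ := (hinv j).cont ψ hψ
      have h0 : ⟪S.toL2 hc, v⟫_ℂ = 0 := hg_dense j _ ⟨ψ, hψ, hc, rfl⟩ v (hv' j)
      rw [S.inner_eq_inner_toLp (Lp.memLp v) (S.memLp_restrict_of_continuous hc), Lp.toLp_coeFn]
      exact h0
    exact Lp.eq_zero_iff_ae_eq_zero.2 (S.ae_eq_zero_of_orth_maximal h4b hF hmax (Lp.memLp v) horth')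
  -- the index set of the non-zero vectors is infinite, hence in bijection with `ℕ`
  set P : Set (ℕ × ℕ) := {p : ℕ × ℕ | g p.1 p.2 ≠ 0} with hP
  have hPinf : P.Infinite := S.infinite_of_total hinf htotal
  haveI : Infinite ↥P := hPinf.to_subtype
  obtain ⟨hden⟩ := nonempty_denumerable ↥P
  let e : ℕ ≃ ↥P := (Denumerable.eqv ↥P).symm
  let idx : ℕ → ℕ × ℕ := fun j => ((e j : ↥P) : ℕ × ℕ)
  have hidx : ∀ j, g (idx j).1 (idx j).2 ≠ 0 := fun j => (e j).2
  have hidx_inj : Function.Injective idx := fun j j' h => e.injective (Subtype.ext h)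
  have hidx_surj : ∀ p ∈ P, ∃ j, idx j = p := fun p hp => ⟨e.symm ⟨p, hp⟩, by simp [idx]⟩
  -- pull the non-zero vectors back to members of the subspaces
  have hchoose : ∀ j : ℕ, ∃ ψ : G → ℂ, ψ ∈ τ (idx j).1 ∧ ∃ hc : Continuous ψ,
      S.toL2 hc = g (idx j).1 (idx j).2 := by
    intro j
    obtain ⟨ψ, hψ, hc, h⟩ := hg_mem _ _ (hidx j)
    exact ⟨ψ, hψ, hc, h.symm⟩
  choose φ hφmem hφc hφeq using hchoose
  -- the prefix vectors are non-zero, so they are listed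
  have hpre_ne : ∀ (i : Fin m) (k : Fin (d i)), g i k ≠ 0 := by
    intro i k h0
    have hk : (k : ℕ) < dj i := by rw [hdj i]; exact k.2
    have hpre := hg_pre i k hk
    have h1 := hwjorth i k hk k hk
    rw [if_pos rfl, S.inner_eq_inner_toL2 ((hinv i).cont _ (hwjmem i k hk))
      ((hinv i).cont _ (hwjmem i k hk)), ← hpre, h0] at h1
    simp at h1
  -- the blocks
  let blk : ∀ i : Fin m, Fin (d i) → ℕ := fun i k => e.symm ⟨((i : ℕ), (k : ℕ)), hpre_ne i k⟩
  have hblk_idx : ∀ (i : Fin m) (k : Fin (d i)), idx (blk i k) = ((i : ℕ), (k : ℕ)) := by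
    intro i k
    simp [idx, blk]
  let Fb : Fin m → Finset ℕ := fun i => Finset.univ.image (blk i)
  have hmemF : ∀ (i : Fin m) (j : ℕ), j ∈ Fb i ↔ ∃ k : Fin (d i), blk i k = j := by
    intro i j
    simp only [Fb, Finset.mem_image, Finset.mem_univ, true_and]
  -- the listed function at a block index IS the prefix function
  have hφblk : ∀ (i : Fin m) (k : Fin (d i)), φ (blk i k) = w i k := by
    intro i k
    have hk : (k : ℕ) < dj i := by rw [hdj i]; exact k.2
    have hpre := hg_pre i k hk
    have hφ := hφeq (blk i k)
    rw [hblk_idx i k] at hφ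
    simp only at hφ
    rw [hpre] at hφ
    have hmem : φ (blk i k) ∈ τ i := by
      have := hφmem (blk i k)
      rw [hblk_idx i k] at this
      exact this
    have hwk : wj i k = w i k := by rw [hwj i]
    rw [← hwk]
    exact eq_of_toL2_eq S ((hinv i).inv _ hmem) (hφc (blk i k)) ((hinv i).inv _ (hwjmem i k hk))
      ((hinv i).cont _ (hwjmem i k hk)) hφ
  refine ⟨τ, φ, fun j => (idx j).1, ⟨hinv, hirr, horthSub, hφmem, fun j j' => ?_, fun ψ hψ hperp => ?_⟩,
    hτV, Fb, fun i i' hne => ?_, fun i j hj => ?_, fun i => ?_⟩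
  · -- orthonormality
    rw [S.inner_eq_inner_toL2 (hφc j) (hφc j'), hφeq j', hφeq j, key _ _ (hidx j') (hidx j)]
    by_cases h : j = j'
    · subst h
      simp
    · rw [if_neg (fun h' => h (hidx_inj h').symm), if_neg h]
  · -- completeness
    have hw : ∀ p ∈ P, ⟪g p.1 p.2, hψ.toLp ψ⟫_ℂ = 0 := by
      intro p hp
      obtain ⟨j, hj⟩ := hidx_surj p hp
      have h1 := hperp j
      rw [S.inner_eq_inner_toLp hψ (S.memLp_restrict_of_continuous (hφc j))] at h1
      have h2 : S.toL2 (hφc j) = (S.memLp_restrict_of_continuous (hφc j)).toLp (φ j) := rfl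
      rw [← h2, hφeq j, hj] at h1
      exact h1
    have h0 : hψ.toLp ψ = 0 := htotal _ hw
    have hcoe := hψ.coeFn_toLp
    rw [h0] at hcoe
    exact hcoe.symm.trans (Lp.coeFn_zero ℂ 2 (S.μ.restrict S.DG))
  · -- disjointness of the blocks
    rw [Finset.disjoint_left]
    intro j hj hj'
    obtain ⟨k, rfl⟩ := (hmemF i j).1 hj
    obtain ⟨k', hk'⟩ := (hmemF i' _).1 hj'
    have h1 := hblk_idx i k
    rw [← hk', hblk_idx i' k'] at h1
    exact hne (Fin.ext (Prod.mk.injEq _ _ _ _ ▸ h1).1).symm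
  · -- `n j = i` on the block
    obtain ⟨k, rfl⟩ := (hmemF i j).1 hj
    simp only [hblk_idx i k]
  · -- the block spans `Wfd i`
    rw [← hwspan i]
    congr 1
    ext f
    constructor
    · rintro ⟨j, hj, rfl⟩
      obtain ⟨k, rfl⟩ := (hmemF i j).1 (Finset.mem_coe.1 hj)
      rw [hφblk i k]
      exact ⟨k, by simp [k.2], rfl⟩
    · rintro ⟨k, hk, rfl⟩
      have hk' : k < d i := by simpa using hk
      refine ⟨blk i ⟨k, hk'⟩, Finset.mem_coe.2 ((hmemF i _).2 ⟨⟨k, hk'⟩, rfl⟩), ?_⟩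
      rw [hφblk i ⟨k, hk'⟩]

end Assembly

end Summit.Ventures.HodgeRepro.Tier4.Line4

end
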